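import Summits.QuantumFields.YangMills.Theorems.LuscherReductionUpperTraceDoorOfCoarseLevels
import Summits.QuantumFields.YangMills.Theorems.LuscherReductionUpperTraceDoorSandwich
import HarnessLib

/-!
# Crux RED `RunningReduction` (stmt-QuantumFields-19978), child `TwistedTraceScaling` (stmt-QuantumFields-20203): the UPPER-HALF TT DOOR —
# THE CONVERSE: `UpperTraceLaw ∧ OneSiteTail ∧ DressedRitz ⟹ TwistedTraceScaling`; given `DressedRitz`, the cuts `{TTS, DressedRitz}` and `{UTL, DressedRitz}` coincide

Support module of the `FemtoTransferGap` group (fleet service by seat ym-infvol-p2 g7; route `LuscherReduction`, owner ym-beyond-p1, femto rung R2b1).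
RE-HOMES VERBATIM §6 of the planner's kernel-checked crux workfile `Summits/QuantumFields/YangMills/Cruxes/RunningReduction/Lines/upper_trace_door.lean`
rev 3 (commit efcd23ff80e7, sha16 fb9acfdf08f96b2f; seat ym-cruxidea-19978-1 GEN 8; memo `…/Lines/upper_trace_door.md` rev 4 §6) in namespace
`…Theorems.FemtoTransferGap.UTD` (credit: the planner's proof, character for character, except that the ≈ 50-line lower-jaw block is the call `UTD.lowerJaw`
of `…UpperTraceDoorBasics` and `1 − e^{−u} ≤ u` is `Real.add_one_le_exp`; UTL is the tree predicate `UTD.UpperTraceLawAt s ε` of `…UpperTraceDoorDefs`,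
quantified `∀ s, 0 < s → ∀ ε, 0 < ε → …` = the workfile's closed `UTD.UpperTraceLaw` by `Iff.rfl`).

* §1 ★★ `twistedTraceScaling_of_upperTraceLaw : (∀ s ε …, UTD.UpperTraceLawAt s ε) → OneSiteTail → DressedRitz → Theses.LuscherReduction.TwistedTraceScaling`
  (the route child 20203 BY NAME; REAL proof, level currency, see the section docstring: UTL at `s` and `2s`, antitonicity in `T`, one-site one-step
  robustness, the dressed-Ritz lower jaw, and the pure-real ratio rule `|b/a² − b₁/a₁²| ≤ |b−b₁| + 2|a−a₁|`; the rigid-grid obstruction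
  `2⌈sL/λ⌉ ≠ ⌈2sL/λ⌉` is met by one-step robustness, not by matching grids); `twistedTraceScaling_of_upperTraceLaw'` (child `OneSiteTail` 20204 CLOSED).
* §2 ★★ `upperTraceLaw_iff_twistedTraceScaling : DressedRitz → ((∀ s ε …, UTD.UpperTraceLawAt s ε) ↔ TwistedTraceScaling)` — with the unconditional
  forward direction `upperTraceLaw_of_twistedTraceScaling'` (`…UpperTraceDoorOfCoarseLevels`): modulo the sibling child `DressedRitz` (stmt-QuantumFields-20205)
  the items `TwistedTraceScaling` and `UpperTraceLaw` are LOGICALLY INTERCHANGEABLE, so a resplit `TTS ↦ UTL` of RED would be STRENGTH-NEUTRAL and change only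
  the SHAPE of the prover's target (one vacuum-normalised inequality at one femto-time, monotone under adding zero-flux spectral weight); conversely, once
  20205 closes, ANY proof of UTL closes TTS by `twistedTraceScaling_of_upperTraceLaw'` — a certificate for the 20203 seats' census (no pivot is executed
  here: owner ruling (R-a), 2026-08-27).  (The workfile's second proof of RED `…_viaTTS` is NOT re-homed: same statement as
  `UTD.runningReduction_of_upperTraceLaw` of `…UpperTraceDoorSandwich` — the gate's dedup rule.)
* §3 NEW: `runningReduction_of_upperTraceLawRaw` ∕ `twistedTraceScaling_of_upperTraceLawRaw` — memo §5 (A)∕(C) glue PRE-CERTIFIED over the ROUTE-FILE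
  SPELLING of the upper trace law (`⌈s * L / luscherLambda β L⌉₊` inlined), so a future resplit's glue item is one `exact`.

HONEST FRAMING: implications among OPEN statements on the femto rung R2b1 (`FemtoGapOfRecord`); UTL ∕ TTS ∕ `DressedRitz` are XL and ASSUMED; nothing here
bears on infinite volume, the continuum limit in large volume, or the Clay mass gap.
References: M. Lüscher, NPB 219 (1983) 233 [cite: Luscher1983, §3]; Reed–Simon IV [cite: ReedSimonIV1978, Thm. XIII.1].
-/

set_option autoImplicit false

noncomputable section

open MeasureTheory Filter Topology Real
open Literature.MathematicalPhysics.QuantumFieldTheory hiding SU2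
open Literature.MathematicalPhysics.QuantumLattice
open Literature.Analysis.OperatorTheory.YMMatrixModel
open scoped BigOperators

namespace Summit.QuantumFields.YangMills.Theorems.FemtoTransferGap.UTD

open Summit.QuantumFields.YangMills.Theorems.FemtoTransferGap
open Summit.QuantumFields.YangMills.Theorems.FemtoTransferGap.TT (physTrace)
open Summit.QuantumFields.YangMills.Theorems.FemtoTransferGap.TraceDoor
open Summit.QuantumFields.YangMills.Theorems.FemtoTransferGap.KTRCalibration (levelValue_antitone)
open Summit.QuantumFields.YangMills.Theses.LuscherReduction (RunningReduction TwistedTraceScaling DressedRitz TraceFormula OneSiteTail)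

/-! ## §1 (workfile §6, GEN 8) The converse: `UpperTraceLaw ∧ DressedRitz ⟹ TwistedTraceScaling` — the cuts `{TTS, DressedRitz}` and `{UTL, DressedRitz}` of RED coincide

Given the sibling child `DressedRitz` (stmt-QuantumFields-20205), the one-sided law and the two-sided dyadic ratio law are EQUIVALENT
(`upperTraceLaw_iff_twistedTraceScaling`).  So the pivot `TwistedTraceScaling ↦ UpperTraceLaw` of child 20203 is strength-neutral for the
route: it changes the SHAPE of what a prover must show (one inequality, vacuum-normalised, monotone under adding spectral weight — comparison /
domination tools admissible), not the logical content of the cut.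

Proof (level currency, `x = λ/L = λ_b(B)`, `T = ⌈sL/λ⌉`, `T₂ = ⌈2sL/λ⌉ ∈ {2T−1, 2T}`; `a = Σ_j z_j^T`, `b = Σ_j z_j^{2T}`, `a₁ = Σ_i y_i^T`, `b₁ = Σ_i y_i^{2T}`,
so that `r_L = b/a²`, `r_1 = b₁/a₁²`):  UPPER `a ≤ a₁ + δ` (UTL at `s`); `b ≤ Σ z^{T₂} ≤ Σ y^{T₂} + δ` (antitone in `T`, UTL at `2s`) and the one-site
one-step robustness `Σ y^{T₂} ≤ b₁ + 2δ` (`y^{T₂} ≤ y^{2T} + (1−y)`, `1 − y_i ≤ (Δ_i+1)x` on the head `i < K` by ONE's coarse lower law, tail `≤ δ` by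
`OneSiteTail`);  LOWER `a ≥ a₁ − 2δ`, `b ≥ b₁ − 2δ` (the jaw `z_j ≥ ρ y_j`, `j ≤ K`, `ρ = e^{−(C⁺λ+η)x}`, from `DressedRitz` (i),(iii) + `ritzBasicsR3` exactly
as in §2, head `≤ K`, tail `≤ δ`);  `a, a₁ ≥ 1`, `0 ≤ b₁ ≤ a₁`;  and the pure-real rule `|b/a² − b₁/a₁²| ≤ |b − b₁| + 2|a − a₁| ≤ 7δ`, `δ = ε/8`. -/

set_option maxHeartbeats 2400000 in
/-- ★★ (GEN 8) **The converse door.**  `UpperTraceLaw ∧ OneSiteTail ∧ DressedRitz ⟹ TwistedTraceScaling` (child 20203 BY NAME; `TraceFormula`, ONE, `ritzBasicsR3`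
closed / landed and used by name; workfile §6, proof VERBATIM but for the `UTD.lowerJaw` call; credit ym-cruxidea-19978-1).  [cite: Luscher1983, §3] [cite: ReedSimonIV1978, Thm. XIII.1] -/
theorem twistedTraceScaling_of_upperTraceLaw (hU : ∀ s : ℝ, 0 < s → ∀ ε : ℝ, 0 < ε → UTD.UpperTraceLawAt s ε)
    (hOST : OneSiteTail) (hDR : DressedRitz) : TwistedTraceScaling := by
  intro s hs ε hε
  -- (1) constants fixed by `(s, ε)`: `δ`; OneSiteTail at `(s, δ)` gives `K, B0`; ONE's coarse lower law on `j ≤ K` gives `B0'`; `G`; `η`; UTL at `s`, `2s`; DressedRitz at `(K, η)`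
  set δ : ℝ := ε / 8 with hδdef
  have hδ : 0 < δ := by rw [hδdef]; positivity
  obtain ⟨K, B0, hK⟩ := hOST s hs δ hδ
  obtain ⟨B0', hB0'⟩ := oneSiteLowerCoarse K 1 one_pos
  set Bs : ℝ := max (max B0 B0') 1 with hBsdef
  have hBs1 : 1 ≤ Bs := le_max_right _ _
  have hBspos : 0 < Bs := one_pos.trans_le hBs1
  have hgapK : 0 ≤ levelGap K := levelGap_nonneg K
  set G : ℝ := (K : ℝ) * (levelGap K + 1) with hGdef
  have hG0 : 0 ≤ G := by rw [hGdef]; positivity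
  have hG1 : 0 < 2 * (G + 1) := by positivity
  have hden : 0 < 4 * ((K : ℝ) + 1) * (s + 1) := by positivity
  set η : ℝ := δ / (4 * ((K : ℝ) + 1) * (s + 1)) with hηdef
  have hη : 0 < η := div_pos hδ hden
  have hηden : η * (4 * ((K : ℝ) + 1) * (s + 1)) = δ := by rw [hηdef]; exact div_mul_cancel₀ _ hden.ne'
  obtain ⟨lamU1, hlamU1, hU1⟩ := hU s hs δ hδ
  obtain ⟨lamU2, hlamU2, hU2⟩ := hU (2 * s) (by positivity) δ hδ
  obtain ⟨C, lamR, hlamR, hR⟩ := hDR K η hη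
  set C1 : ℝ := max C 0 with hC1def
  have hC10 : 0 ≤ C1 := le_max_right _ _
  have hCC1 : C ≤ C1 := le_max_left _ _
  have h2C1 : 0 < 2 * C1 + 1 := by linarith only [hC10]
  have hq1 : 0 < η / (2 * C1 + 1) := div_pos hη h2C1
  have hq2 : 0 < 1 / (4 * Bs) := by positivity
  have hq3 : 0 < δ / (2 * (G + 1)) := div_pos hδ hG1
  have hq4 : 0 < s / 4 := by positivity
  refine ⟨min (min (min lamU1 lamU2) lamR) (min (min (s / 4) (1 / 8)) (min (1 / (4 * Bs)) (min (η / (2 * C1 + 1)) (δ / (2 * (G + 1)))))),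
    lt_min (lt_min (lt_min hlamU1 hlamU2) hlamR) (lt_min (lt_min hq4 (by norm_num)) (lt_min hq2 (lt_min hq1 hq3))), fun lam hlam hlamle => ?_⟩
  have hlamU1' : lam ≤ lamU1 := hlamle.trans ((min_le_left _ _).trans ((min_le_left _ _).trans (min_le_left _ _)))
  have hlamU2' : lam ≤ lamU2 := hlamle.trans ((min_le_left _ _).trans ((min_le_left _ _).trans (min_le_right _ _)))
  have hlamR' : lam ≤ lamR := hlamle.trans ((min_le_left _ _).trans (min_le_right _ _))
  have hlams : lam ≤ s / 4 := hlamle.trans ((min_le_right _ _).trans ((min_le_left _ _).trans (min_le_left _ _)))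
  have hlam8 : lam ≤ 1 / 8 := hlamle.trans ((min_le_right _ _).trans ((min_le_left _ _).trans (min_le_right _ _)))
  have hlamB : lam ≤ 1 / (4 * Bs) := hlamle.trans ((min_le_right _ _).trans ((min_le_right _ _).trans (min_le_left _ _)))
  have hlamη : lam ≤ η / (2 * C1 + 1) :=
    hlamle.trans ((min_le_right _ _).trans ((min_le_right _ _).trans ((min_le_right _ _).trans (min_le_left _ _))))
  have hlamG : lam ≤ δ / (2 * (G + 1)) :=
    hlamle.trans ((min_le_right _ _).trans ((min_le_right _ _).trans ((min_le_right _ _).trans (min_le_right _ _))))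
  obtain ⟨LU1, hLU1⟩ := hU1 lam hlam hlamU1'
  obtain ⟨LU2, hLU2⟩ := hU2 lam hlam hlamU2'
  obtain ⟨LR, hLR⟩ := hR lam hlam hlamR'
  refine ⟨max (max LU1 LU2) LR, fun L _ hL β hW => ?_⟩
  have hLU1' : LU1 ≤ L := ((le_max_left _ _).trans (le_max_left _ _)).trans hL
  have hLU2' : LU2 ≤ L := ((le_max_right _ _).trans (le_max_left _ _)).trans hL
  have hLR' : LR ≤ L := (le_max_right _ _).trans hL
  show |physTrace L β (2 * femtoSteps s β L) / physTrace L β (femtoSteps s β L) ^ 2 -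
      physTrace 1 (oneSiteCoupling β L) (2 * femtoSteps s β L) / physTrace 1 (oneSiteCoupling β L) (femtoSteps s β L) ^ 2| ≤ ε
  -- (2) the eventual hypotheses at this `(L, β)`
  have hUTL1 := hLU1 L hLU1' β hW
  have hUTL2 := hLU2 L hLU2' β hW
  obtain ⟨φ, hφphys, hφon, hφdiag, hφanti, hratio, -, hcap⟩ := hLR L hLR' β hW
  have hBge : Bs ≤ oneSiteCoupling β L := oneSiteCoupling_ge_of_small hlam hW hBspos hlam8 hlamB
  obtain ⟨hβ, hlamle', hlam2⟩ := hW
  -- scales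
  set l : ℝ := luscherLambda β L with hldef
  have hlpos : 0 < l := hlam.trans_le hlamle'
  have hLpos : (0 : ℝ) < L := Nat.cast_pos.mpr (NeZero.pos L)
  have hL1 : (1 : ℝ) ≤ L := by exact_mod_cast NeZero.one_le
  set x : ℝ := l / L with hxdef
  have hxpos : 0 < x := div_pos hlpos hLpos
  have hxl : x ≤ l := div_le_self hlpos.le hL1
  have hx1 : x ≤ 1 := by linarith only [hxl, hlam2, hlam8]
  have hx2 : x ≤ s / 2 := by linarith only [hxl, hlam2, hlams]
  have hlx : 0 < l * x := mul_pos hlpos hxpos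
  set B : ℝ := oneSiteCoupling β L with hBdef
  have hB0B : B0 ≤ B := ((le_max_left _ _).trans (le_max_left _ _)).trans hBge
  have hB0'B : B0' ≤ B := ((le_max_right _ _).trans (le_max_left _ _)).trans hBge
  have hB1 : 1 ≤ B := hBs1.trans hBge
  have hbl : bareLambda B = x := by rw [hBdef, hxdef, hldef]; exact bareLambda_oneSiteCoupling hlpos
  have hmu0 : 0 < levelValue su2Rep 1 B 0 := levelValue_zero_su2Rep_pos 1 B
  have hl0 : 0 < levelValue su2Rep L β 0 := levelValue_zero_su2Rep_pos L β
  have hmunn : ∀ i : ℕ, 0 ≤ levelValue su2Rep 1 B i := fun i => transferValuesNonneg 1 B i hB1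
  -- times `T = ⌈sL/λ⌉ ≥ 2`, `T₂ = ⌈2sL/λ⌉ ∈ [T, 2T]`, `2T ≤ T₂ + 1`
  set T : ℕ := femtoSteps s β L with hTdef
  set T₂ : ℕ := femtoSteps (2 * s) β L with hT₂def
  obtain ⟨hτlo0, hτhi0⟩ := femtoSteps_mul_bounds (s := s) (β := β) (L := L) hs.le hlpos
  have hτlo : s ≤ (T : ℝ) * x := hτlo0
  have hτhi : (T : ℝ) * x ≤ s + x := hτhi0
  obtain ⟨hτ₂lo0, -⟩ := femtoSteps_mul_bounds (s := 2 * s) (β := β) (L := L) (by positivity) hlpos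
  have hτ₂lo : 2 * s ≤ (T₂ : ℝ) * x := hτ₂lo0
  have hT2r : (2 : ℝ) ≤ T := by
    have h1 : 2 * x ≤ (T : ℝ) * x := by linarith only [hx2, hτlo]
    exact le_of_mul_le_mul_right h1 hxpos
  have hT2 : 2 ≤ T := by exact_mod_cast hT2r
  have hTT₂ : T ≤ T₂ := femtoSteps_mono (by linarith only [hs]) hlpos.le
  have hT₂2 : 2 ≤ T₂ := hT2.trans hTT₂
  have h2T2 : 2 ≤ 2 * T := by omega
  have hT₂le : T₂ ≤ 2 * T := femtoSteps_two_mul_le s β L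
  have h2Tle : 2 * T ≤ T₂ + 1 := two_mul_femtoSteps_le hs.le hlpos
  have hτ1 : (T : ℝ) * x ≤ s + 1 := by linarith only [hτhi, hx1]
  have hτ1' : (T : ℝ) * x ≤ 2 * (s + 1) := by linarith only [hτ1, hs]
  have h2τ : ((2 * T : ℕ) : ℝ) * x ≤ 2 * (s + 1) := by push_cast; linarith only [hτ1]
  -- normalised levels on both lattices
  set y : ℕ → ℝ := xval 1 B with hydef
  set z : ℕ → ℝ := xval L β with hzdef
  have hy0 : ∀ i, 0 ≤ y i := fun i => xval_nonneg hB1 i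
  have hy1 : ∀ i, y i ≤ 1 := fun i => xval_le_one hB1 i
  have hz0 : ∀ j, 0 ≤ z j := fun j => xval_nonneg hβ j
  have hz1 : ∀ j, z j ≤ 1 := fun j => xval_le_one hβ j
  have hy0one : y 0 = 1 := by show levelValue su2Rep 1 B 0 / levelValue su2Rep 1 B 0 = 1; exact div_self hmu0.ne'
  have hz0one : z 0 = 1 := by show levelValue su2Rep L β 0 / levelValue su2Rep L β 0 = 1; exact div_self hl0.ne'
  have hHS := hasSum_xval_pow (L := L) (β := β) hβ hT2
  have hHS2 := hasSum_xval_pow (L := L) (β := β) hβ h2T2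
  have hHS₂ := hasSum_xval_pow (L := L) (β := β) hβ hT₂2
  have hHS1 := hasSum_xval_pow (L := 1) (β := B) hB1 hT2
  have hHS12 := hasSum_xval_pow (L := 1) (β := B) hB1 h2T2
  have hHS1₂ := hasSum_xval_pow (L := 1) (β := B) hB1 hT₂2
  have hsumzT : Summable (fun j => z j ^ T) := hHS.summable
  have hsumz2T : Summable (fun j => z j ^ (2 * T)) := hHS2.summable
  have hsumzT₂ : Summable (fun j => z j ^ T₂) := hHS₂.summable
  have hsumyT : Summable (fun i => y i ^ T) := hHS1.summable
  have hsumy2T : Summable (fun i => y i ^ (2 * T)) := hHS12.summable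
  have hsumyT₂ : Summable (fun i => y i ^ T₂) := hHS1₂.summable
  -- OneSiteTail at `T`, `2T`, `T₂` (admissible: `s ≤ 2·T'·x`)
  have hadmT : s ≤ 2 * ((T : ℝ) * bareLambda B) := by rw [hbl]; linarith only [hτlo, hs]
  have hadm2T : s ≤ 2 * (((2 * T : ℕ) : ℝ) * bareLambda B) := by rw [hbl]; push_cast; nlinarith only [hτlo, hs, hxpos]
  have hadmT₂ : s ≤ 2 * ((T₂ : ℝ) * bareLambda B) := by rw [hbl]; linarith only [hτ₂lo, hs]
  obtain ⟨-, htailT⟩ := hK B hB0B T hadmT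
  obtain ⟨-, htail2T⟩ := hK B hB0B (2 * T) hadm2T
  obtain ⟨-, htailT₂⟩ := hK B hB0B T₂ hadmT₂
  have htailT' : ∑' i, y (i + K) ^ T ≤ δ := htailT
  have htail2T' : ∑' i, y (i + K) ^ (2 * T) ≤ δ := htail2T
  have htailT₂' : ∑' i, y (i + K) ^ T₂ ≤ δ := htailT₂
  -- the six Laplace sums
  set a : ℝ := ∑' j, z j ^ T with hadef
  set b : ℝ := ∑' j, z j ^ (2 * T) with hbdef
  set a₂ : ℝ := ∑' j, z j ^ T₂ with ha₂def
  set a₁ : ℝ := ∑' i, y i ^ T with ha₁def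
  set b₁ : ℝ := ∑' i, y i ^ (2 * T) with hb₁def
  set c₂ : ℝ := ∑' i, y i ^ T₂ with hc₂def
  -- (3) UPPER: UTL at `s` and `2s` in level currency, antitonicity, one-site robustness
  have hU1c : a ≤ a₁ + δ := by
    rw [hadef, ha₁def, hHS.tsum_eq, hHS1.tsum_eq, div_le_iff₀ (pow_pos hl0 T)]
    exact hUTL1
  have hU2c : a₂ ≤ c₂ + δ := by
    rw [ha₂def, hc₂def, hHS₂.tsum_eq, hHS1₂.tsum_eq, div_le_iff₀ (pow_pos hl0 T₂)]
    exact hUTL2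
  have hA : b ≤ a₂ := by
    rw [hbdef, ha₂def]
    exact hsumz2T.tsum_le_tsum (fun j => pow_le_pow_of_le_one (hz0 j) (hz1 j) hT₂le) hsumzT₂
  have hlow1 := (hB0' B hB0'B).2
  have hRob : c₂ ≤ b₁ + 2 * δ := by
    have hsplit : c₂ = ∑ i ∈ Finset.range K, y i ^ T₂ + ∑' i, y (i + K) ^ T₂ := by
      rw [hc₂def]; exact (hsumyT₂.sum_add_tsum_nat_add K).symm
    have hhead2T : ∑ i ∈ Finset.range K, y i ^ (2 * T) ≤ b₁ := by
      rw [hb₁def]; exact hsumy2T.sum_le_tsum (Finset.range K) (fun i _ => pow_nonneg (hy0 i) _)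
    have hterm : ∀ i ∈ Finset.range K, y i ^ T₂ ≤ y i ^ (2 * T) + (levelGap K + 1) * x := by
      intro i hi
      have hiK : i ≤ K := (Finset.mem_range.mp hi).le
      have h1 : y i ^ T₂ ≤ y i ^ (2 * T) + (1 - y i) := pow_le_pow_add_one_sub (hy0 i) (hy1 i) h2Tle
      have hlow : Real.exp (-((levelGap i + 1) * bareLambda B)) * levelValue su2Rep 1 B 0 ≤ levelValue su2Rep 1 B i := hlow1 i hiK
      have hyi : Real.exp (-((levelGap i + 1) * x)) ≤ y i := by
        show _ ≤ levelValue su2Rep 1 B i / levelValue su2Rep 1 B 0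
        rw [le_div_iff₀ hmu0, ← hbl]; exact hlow
      have h2 : 1 - y i ≤ (levelGap i + 1) * x := by
        have := Real.add_one_le_exp (-((levelGap i + 1) * x)); linarith only [this, hyi]
      have h3 : (levelGap i + 1) * x ≤ (levelGap K + 1) * x :=
        mul_le_mul_of_nonneg_right (by linarith only [levelGap_mono hiK]) hxpos.le
      linarith only [h1, h2, h3]
    have hhead : ∑ i ∈ Finset.range K, y i ^ T₂ ≤ ∑ i ∈ Finset.range K, y i ^ (2 * T) + (K : ℝ) * ((levelGap K + 1) * x) := by
      calc ∑ i ∈ Finset.range K, y i ^ T₂ ≤ ∑ i ∈ Finset.range K, (y i ^ (2 * T) + (levelGap K + 1) * x) := Finset.sum_le_sum hterm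
        _ = ∑ i ∈ Finset.range K, y i ^ (2 * T) + (K : ℝ) * ((levelGap K + 1) * x) := by
            rw [Finset.sum_add_distrib, Finset.sum_const, Finset.card_range, nsmul_eq_mul]
    have hGx : (K : ℝ) * ((levelGap K + 1) * x) ≤ δ := by
      have h1 : (K : ℝ) * ((levelGap K + 1) * x) = G * x := by rw [hGdef]; ring
      have h2 : G * x ≤ (G + 1) * (2 * lam) := mul_le_mul (by linarith only []) (by linarith only [hxl, hlam2]) hxpos.le (by positivity)
      have h3 : (G + 1) * (2 * lam) ≤ δ := by
        have h4 := hlamG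
        rw [le_div_iff₀ hG1] at h4; linarith only [h4]
      linarith only [h1, h2, h3]
    rw [hsplit]; linarith only [hhead, hGx, htailT₂', hhead2T]
  -- (4) LOWER: the dressed Ritz family gives the jaw `ρ y_j ≤ z_j` for `j ≤ K` (`UTD.lowerJaw`)
  set ρ : ℝ := Real.exp (-((C1 * l + η) * x)) with hρdef
  have hρpos : 0 < ρ := Real.exp_pos _
  have hClη : 0 ≤ (C1 * l + η) * x := by positivity
  have hρ1 : ρ ≤ 1 := by
    rw [hρdef]; exact Real.exp_le_one_iff.mpr (by linarith only [hClη])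
  have hlow : ∀ j : ℕ, j ≤ K → ρ * y j ≤ z j :=
    lowerJaw hβ hB1 hlpos hCC1 φ hφphys hφon hφdiag hφanti hratio hcap
  have hCl : C1 * l ≤ η := by
    have h3 : 2 * C1 / (2 * C1 + 1) ≤ 1 := by rw [div_le_one h2C1]; linarith only [hC10]
    calc C1 * l ≤ C1 * (2 * (η / (2 * C1 + 1))) := mul_le_mul_of_nonneg_left (by linarith only [hlam2, hlamη]) hC10
      _ = η * (2 * C1 / (2 * C1 + 1)) := by ring
      _ ≤ η * 1 := mul_le_mul_of_nonneg_left h3 hη.le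
      _ = η := mul_one η
  have h2η : C1 * l + η ≤ 2 * η := by linarith only [hCl]
  -- the lower jaw at any admissible time `T'`
  have hjaw : ∀ T' : ℕ, Summable (fun j => z j ^ T') → Summable (fun i => y i ^ T') → ∑' i, y (i + K) ^ T' ≤ δ →
      (T' : ℝ) * x ≤ 2 * (s + 1) → ∑' i, y i ^ T' - 2 * δ ≤ ∑' j, z j ^ T' := by
    intro T' hsz hsy htl hτ'
    have hfin : ∑ j ∈ Finset.range K, z j ^ T' ≤ ∑' j, z j ^ T' :=
      hsz.sum_le_tsum (Finset.range K) (fun j _ => pow_nonneg (hz0 j) T')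
    have hheadlow : ρ ^ T' * ∑ j ∈ Finset.range K, y j ^ T' ≤ ∑ j ∈ Finset.range K, z j ^ T' := by
      rw [Finset.mul_sum]
      apply Finset.sum_le_sum
      intro j hj
      have hjK : j ≤ K := (Finset.mem_range.mp hj).le
      have := pow_le_pow_left₀ (mul_nonneg hρpos.le (hy0 j)) (hlow j hjK) T'
      rwa [mul_pow] at this
    have hsplit : ∑' i, y i ^ T' = ∑ i ∈ Finset.range K, y i ^ T' + ∑' i, y (i + K) ^ T' := (hsy.sum_add_tsum_nat_add K).symm
    have hS0 : 0 ≤ ∑ i ∈ Finset.range K, y i ^ T' := Finset.sum_nonneg fun i _ => pow_nonneg (hy0 i) T'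
    have hSK : ∑ i ∈ Finset.range K, y i ^ T' ≤ K := by
      calc ∑ i ∈ Finset.range K, y i ^ T' ≤ ∑ i ∈ Finset.range K, (1 : ℝ) := Finset.sum_le_sum fun i _ => pow_le_one₀ (hy0 i) (hy1 i)
        _ = K := by simp
    have hρT : 1 - ρ ^ T' ≤ (C1 * l + η) * ((T' : ℝ) * x) := by
      have e : ρ ^ T' = Real.exp (-((C1 * l + η) * ((T' : ℝ) * x))) := by
        rw [hρdef, ← Real.exp_nat_mul]; congr 1; ring
      rw [e]; linarith only [Real.add_one_le_exp (-((C1 * l + η) * ((T' : ℝ) * x)))]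
    have hsmall : (1 - ρ ^ T') * ∑ i ∈ Finset.range K, y i ^ T' ≤ δ := by
      have h1 : (1 - ρ ^ T') * ∑ i ∈ Finset.range K, y i ^ T' ≤ ((C1 * l + η) * ((T' : ℝ) * x)) * K :=
        mul_le_mul hρT hSK hS0 (by positivity)
      have h2 : (C1 * l + η) * ((T' : ℝ) * x) ≤ (2 * η) * (2 * (s + 1)) := mul_le_mul h2η hτ' (by positivity) (by positivity)
      have h3 : ((C1 * l + η) * ((T' : ℝ) * x)) * K ≤ ((2 * η) * (2 * (s + 1))) * K := mul_le_mul_of_nonneg_right h2 (Nat.cast_nonneg K)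
      have hK0 : (0 : ℝ) ≤ K := Nat.cast_nonneg K
      have h4 : ((2 * η) * (2 * (s + 1))) * K ≤ η * (4 * ((K : ℝ) + 1) * (s + 1)) := by nlinarith only [hη.le, hs.le, hK0]
      linarith only [h1, h3, h4, hηden]
    have e1 : ρ ^ T' * ∑ i ∈ Finset.range K, y i ^ T' =
        ∑ i ∈ Finset.range K, y i ^ T' - (1 - ρ ^ T') * ∑ i ∈ Finset.range K, y i ^ T' := by ring
    rw [hsplit]
    linarith only [hheadlow, hfin, hsmall, htl, e1]
  have hL1 : a₁ - 2 * δ ≤ a := by rw [hadef, ha₁def]; exact hjaw T hsumzT hsumyT htailT' hτ1'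
  have hL2 : b₁ - 2 * δ ≤ b := by rw [hbdef, hb₁def]; exact hjaw (2 * T) hsumz2T hsumy2T htail2T' h2τ
  -- (5) sizes: `a, a₁ ≥ 1`, `0 ≤ b₁ ≤ a₁`
  have ha1 : 1 ≤ a := by
    have h := le_hasSum hHS 0 (fun j _ => pow_nonneg (hz0 j) T)
    have e : xval L β 0 ^ T = 1 := by show z 0 ^ T = 1; rw [hz0one, one_pow]
    rw [e] at h
    rw [hadef, hHS.tsum_eq]; exact h
  have ha₁1 : 1 ≤ a₁ := by
    have h := le_hasSum hHS1 0 (fun j _ => pow_nonneg (hy0 j) T)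
    have e : xval 1 B 0 ^ T = 1 := by show y 0 ^ T = 1; rw [hy0one, one_pow]
    rw [e] at h
    rw [ha₁def, hHS1.tsum_eq]; exact h
  have hb₁0 : 0 ≤ b₁ := by rw [hb₁def]; exact tsum_nonneg fun i => pow_nonneg (hy0 i) _
  have hb₁a₁ : b₁ ≤ a₁ := by
    rw [hb₁def, ha₁def]
    exact hsumy2T.tsum_le_tsum (fun i => pow_le_pow_of_le_one (hy0 i) (hy1 i) (by omega)) hsumyT
  -- (6) the ratio rule
  have hab : |a - a₁| ≤ 2 * δ := abs_sub_le_iff.2 ⟨by linarith only [hU1c, hδ], by linarith only [hL1]⟩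
  have hbb : |b - b₁| ≤ 3 * δ := abs_sub_le_iff.2 ⟨by linarith only [hA, hU2c, hRob], by linarith only [hL2, hδ]⟩
  have hkey : |b / a ^ 2 - b₁ / a₁ ^ 2| ≤ ε := by
    have h := ratio_rule (b := b) (b₁ := b₁) ha1 ha₁1 hb₁0 hb₁a₁
    have e : ε = 8 * δ := by rw [hδdef]; ring
    rw [e]; linarith only [h, hab, hbb, hδ]
  -- (7) back to traces: `r_L = b/a²`, `r_1 = b₁/a₁²`
  have hl0T : 0 < levelValue su2Rep L β 0 ^ T := pow_pos hl0 T
  have hmu0T : 0 < levelValue su2Rep 1 B 0 ^ T := pow_pos hmu0 T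
  have ea : a = physTrace L β T / levelValue su2Rep L β 0 ^ T := by rw [hadef]; exact hHS.tsum_eq
  have eb : b = physTrace L β (2 * T) / (levelValue su2Rep L β 0 ^ T) ^ 2 := by
    rw [hbdef, hHS2.tsum_eq, ← pow_mul, mul_comm T 2]
  have ea₁ : a₁ = physTrace 1 B T / levelValue su2Rep 1 B 0 ^ T := by rw [ha₁def]; exact hHS1.tsum_eq
  have eb₁ : b₁ = physTrace 1 B (2 * T) / (levelValue su2Rep 1 B 0 ^ T) ^ 2 := by
    rw [hb₁def, hHS12.tsum_eq, ← pow_mul, mul_comm T 2]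
  have er : physTrace L β (2 * T) / physTrace L β T ^ 2 = b / a ^ 2 := by
    rw [ea, eb, div_pow, div_div_div_cancel_right₀ (pow_ne_zero 2 hl0T.ne')]
  have er₁ : physTrace 1 B (2 * T) / physTrace 1 B T ^ 2 = b₁ / a₁ ^ 2 := by
    rw [ea₁, eb₁, div_pow, div_div_div_cancel_right₀ (pow_ne_zero 2 hmu0T.ne')]
  rw [er, er₁]
  exact hkey

/-- The converse door with the CLOSED child `OneSiteTail` (stmt-QuantumFields-20204, `OST.oneSiteTail_proof`) discharged by name (workfile §6).
[cite: Luscher1983, §3] -/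
theorem twistedTraceScaling_of_upperTraceLaw' (hU : ∀ s : ℝ, 0 < s → ∀ ε : ℝ, 0 < ε → UTD.UpperTraceLawAt s ε) (hDR : DressedRitz) :
    TwistedTraceScaling :=
  twistedTraceScaling_of_upperTraceLaw hU OST.oneSiteTail_proof hDR

/-! ## §2 The two cuts coincide -/

/-- ★★ (workfile §6, GEN 8) **The two cuts coincide.**  Given the sibling child `DressedRitz` (stmt-QuantumFields-20205), the ONE-SIDED law
`UpperTraceLaw` (`∀ s ε, UTD.UpperTraceLawAt s ε`) and the route's TWO-SIDED child `TwistedTraceScaling` (stmt-QuantumFields-20203) are EQUIVALENT; the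
forward direction needs no hypothesis at all (`upperTraceLaw_of_twistedTraceScaling'`).  Credit ym-cruxidea-19978-1. [cite: Luscher1983, §3] -/
theorem upperTraceLaw_iff_twistedTraceScaling (hDR : DressedRitz) :
    (∀ s : ℝ, 0 < s → ∀ ε : ℝ, 0 < ε → UTD.UpperTraceLawAt s ε) ↔ TwistedTraceScaling :=
  ⟨fun hU => twistedTraceScaling_of_upperTraceLaw' hU hDR, upperTraceLaw_of_twistedTraceScaling'⟩

/-! ## §3 NEW: the resplit glue of memo §5 (A)∕(C), PRE-CERTIFIED over the ROUTE-FILE SPELLING of the upper trace law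

If the owner ever executes the (R-a) pivot — RED resplit as `TraceFormula → UpperTraceLaw → OneSiteTail → DressedRitz → RunningReduction` with
`UpperTraceLaw` typed in the route-file spelling of memo §5 (`⌈s * L / luscherLambda β L⌉₊` inlined; `UTD.upperTraceLawAt_iff_raw` is `Iff.rfl`) — the
glue item is closed by `exact UTD.runningReduction_of_upperTraceLawRaw`, and a 20203-internal «sandwich» line (memo §5 (C): stubs = the raw upper trace law
and `DressedRitz`) composes by `UTD.twistedTraceScaling_of_upperTraceLawRaw`.  The closed children `TraceFormula` (20202) ∕ `OneSiteTail` (20204) are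
listed only to match the glue shape (they are tree theorems and are not consumed).  Nothing is pivoted here (owner ruling (R-a): PARK stands). -/

/-- Memo §5 (A) glue, pre-certified: `TraceFormula → ⟨upper trace law, route-file spelling⟩ → OneSiteTail → DressedRitz → RunningReduction` (RED BY NAME;
= `UTD.runningReduction_of_upperTraceLaw` up to `Iff.rfl`).  CONDITIONAL on the two XL hypotheses. [cite: Luscher1983, §3] -/
theorem runningReduction_of_upperTraceLawRaw (_hTF : TraceFormula)
    (hU : ∀ s : ℝ, 0 < s → ∀ ε : ℝ, 0 < ε → ∃ lam0 : ℝ, 0 < lam0 ∧ ∀ lam : ℝ, 0 < lam → lam ≤ lam0 →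
      ∃ L0 : ℕ, ∀ (L : ℕ) [NeZero L], L0 ≤ L → ∀ β : ℝ, InFemtoWindow lam β L →
        physTrace L β ⌈s * L / luscherLambda β L⌉₊ ≤
          (physTrace 1 (oneSiteCoupling β L) ⌈s * L / luscherLambda β L⌉₊ /
                levelValue su2Rep 1 (oneSiteCoupling β L) 0 ^ ⌈s * L / luscherLambda β L⌉₊ + ε) *
            levelValue su2Rep L β 0 ^ ⌈s * L / luscherLambda β L⌉₊)
    (_hOST : OneSiteTail) (hDR : DressedRitz) :
    Summit.QuantumFields.YangMills.Theses.LuscherReduction.RunningReduction :=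
  runningReduction_of_upperTraceLaw hU hDR

/-- Memo §5 (C) composition, pre-certified: `⟨upper trace law, route-file spelling⟩ → OneSiteTail → DressedRitz → TwistedTraceScaling` (child 20203 BY
NAME; = `UTD.twistedTraceScaling_of_upperTraceLaw` up to `Iff.rfl`).  CONDITIONAL on the XL hypotheses. [cite: Luscher1983, §3] -/
theorem twistedTraceScaling_of_upperTraceLawRaw
    (hU : ∀ s : ℝ, 0 < s → ∀ ε : ℝ, 0 < ε → ∃ lam0 : ℝ, 0 < lam0 ∧ ∀ lam : ℝ, 0 < lam → lam ≤ lam0 →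
      ∃ L0 : ℕ, ∀ (L : ℕ) [NeZero L], L0 ≤ L → ∀ β : ℝ, InFemtoWindow lam β L →
        physTrace L β ⌈s * L / luscherLambda β L⌉₊ ≤
          (physTrace 1 (oneSiteCoupling β L) ⌈s * L / luscherLambda β L⌉₊ /
                levelValue su2Rep 1 (oneSiteCoupling β L) 0 ^ ⌈s * L / luscherLambda β L⌉₊ + ε) *
            levelValue su2Rep L β 0 ^ ⌈s * L / luscherLambda β L⌉₊)
    (hOST : OneSiteTail) (hDR : DressedRitz) : TwistedTraceScaling :=
  twistedTraceScaling_of_upperTraceLaw hU hOST hDR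

end Summit.QuantumFields.YangMills.Theorems.FemtoTransferGap.UTD

end
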